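import Mathlib
import HarnessLib
import Summits.HubbardSuperconductivity.HubbardSuperconductivity.Theorems.KLProgrammeKLRegimeWickCrossContractionGramSized

/-!
# Route `KLProgramme` — ENGINE child gen 6 (stmt-HubbardSuperconductivity-20236 `KLRegimeEngineV16`), `stub_engine_step_values` (E2-v10):
# the NORM form with a Gram tail in the FAMILY keying (k-uniform Gram base), lines via the fat family `Ft`, vertices the `F`-sector preimages
# (cell gate-hubbard-kl, seat p5 g5; the norm-form twin of `…WickCrossContractionGramFamily`)

`…GramSized` keys the Gram data by line (base `Σ_{i<k} κ_i²`, fine for fixed `k`).  For the line-number tail the base must not grow with `k`: key by a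
finite symbol family `sym : ι → symbols` with a line assignment `τ : Fin k → ι` (the step's terms carry the three symbols `g_{n+1}`, `D_n`, `D_{n+1}`):

* **`sum_norm_kernel_crossContract_pullback_le_gramF`** — pinned output leg from `a`, arbitrary vertices, lines `S(Ft)ᵀ·C_{sym(τ i)}·S(Ft)`, base `Σ_{s∈ι} κ_s²`;
* **`sum_norm_kernel_crossContract_sectorPreimage_le_gramF`** — engine currency: `Ga` in the plain `F`-norm `‖Ga‖_{k+m₀, univ}`, `Gb` pinned at its
  line-`0` leg with the sectors of its explicit legs prescribed (`F`-level `e'`).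

Pure bookkeeping; no definitions, no named facts.
-/

noncomputable section

namespace Summit.HubbardSuperconductivity.HubbardSuperconductivity.Theorems.KLRegimeWick

set_option linter.dupNamespace false -- summit = problem name (single-conjunct summit), D-0017

open Literature.MathematicalPhysics.QuantumLattice Literature.Probability.LatticeModels GrassmannAlgebra Finset Matrix
open Summit.HubbardSuperconductivity.HubbardSuperconductivity.Theorems.KLRegimeSplit
open scoped InnerProductSpace

section FamilyNorm

variable {L M N : ℕ} [NeZero L] {ι : Type*} [Fintype ι] [DecidableEq ι]

/-- Charges in `Fin 2` with `[a = 0] ↔ [b = 0]` are equal. -/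
private theorem fin_two_eq_of_iff' {a b : Fin 2} (h : a = 0 ↔ b = 0) : a = b := by
  rw [Fin.ext_iff, Fin.ext_iff, Fin.val_zero] at h
  rw [Fin.ext_iff]
  have ha := a.isLt
  have hb := b.isLt
  omega

/-- **Norm form with a Gram tail, family keying, pinned at a free leg of `a`** (lines `S(Ft)ᵀ·C_{sym(τ i)}·S(Ft)`; overlap `4ρ₀`, row sums `α`,
entries `δ_i`, Gram half-norms `κ_s` per SYMBOL; base `Σ_{s∈ι} κ_s²`). [cite: BenfattoGiulianiMastropietro2006, §2.8 (2.80)] -/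
theorem sum_norm_kernel_crossContract_pullback_le_gramF {k e' m m₀ m₁ : ℕ} (he : e' + 1 ≤ k) (β : ℝ) (Ft : Fin N → FreqMomentum L M → ℂ)
    {ρ₀ : ℕ} (hρ₀ : ∀ ω : Fin N, ((univ : Finset (Fin N)).filter fun ω' => ∃ q, Ft ω q * Ft ω' q ≠ 0).card ≤ ρ₀)
    (sym : ι → FreqMomentum L M × Fin 2 → ℂ) (τ : Fin k → ι) (κ : ι → ℝ)
    (hκF : ∀ (s : ι) (Y : SpaceTimeIdx L M × SectorLeg N), Y.2.2 = 0 → ‖sectorGramF L M β Ft (sym s) Y‖ ≤ κ s)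
    (hκG : ∀ (s : ι) (Y : SpaceTimeIdx L M × SectorLeg N), Y.2.2 = 1 → ‖sectorGramG L M β Ft (sym s) Y‖ ≤ κ s)
    (a b : GrassmannAlgebra ℂ (SpaceTimeIdx L M × SectorLeg N)) (s : Fin m → Fin 2)
    (hm₀ : (univ.filter fun i => s i = 0).card = m₀) (hm₁ : (univ.filter fun i => s i = 1).card = m₁) (p : Fin m) (hp : s p = 0)
    (z : SpaceTimeIdx L M × SectorLeg N) {α : ℝ}
    (hrow : ∀ X, ∑ Y, ‖((sectorSubMatrix L M β Ft).transpose * normalCovariance L M (sym (τ (Fin.castLE he 0))) * sectorSubMatrix L M β Ft) X Y‖ ≤ α)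
    (hcol : ∀ Y, ∑ X, ‖((sectorSubMatrix L M β Ft).transpose * normalCovariance L M (sym (τ (Fin.castLE he 0))) * sectorSubMatrix L M β Ft) X Y‖ ≤ α)
    (δ : Fin e' → ℝ) (hδ : ∀ i, 0 ≤ δ i)
    (hent : ∀ (i : Fin e') X Y,
      ‖((sectorSubMatrix L M β Ft).transpose * normalCovariance L M (sym (τ (Fin.castLE he i.succ))) * sectorSubMatrix L M β Ft) X Y‖ ≤ δ i)
    {Na Nb : ℝ} (hNb0 : 0 ≤ Nb)
    (hNa : ∀ p₀ : Fin m₀, ∑ X : Fin k → SpaceTimeIdx L M × SectorLeg N,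
      ∑ X₀ ∈ univ.filter (fun X₀ : Fin m₀ → SpaceTimeIdx L M × SectorLeg N => X₀ p₀ = z), ‖kernel ℂ a (k + m₀) (Fin.append X X₀)‖ ≤ Na)
    (hNb : ∀ (Y₀ : SpaceTimeIdx L M × SectorLeg N) (τ' : Fin e' → SectorLeg N), ∑ y : Fin e' → SpaceTimeIdx L M,
      ∑ Y₁ : Fin m₁ → SpaceTimeIdx L M × SectorLeg N, ∑ Y ∈ univ.filter (fun Y : Fin k → SpaceTimeIdx L M × SectorLeg N =>
        (fun i => Y (Fin.castLE he i)) = (Fin.cons Y₀ (fun i => (y i, τ' i)) : Fin (e' + 1) → SpaceTimeIdx L M × SectorLeg N)),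
          ‖kernel ℂ b (k + m₁) (Fin.append Y Y₁)‖ ≤ Nb) :
    ∑ Z ∈ univ.filter (fun Z : Fin m → SpaceTimeIdx L M × SectorLeg N => Z p = z),
        ‖kernel ℂ (((List.ofFn fun i => grassmannLaplacian ℂ (crossCov ℂ
            ((sectorSubMatrix L M β Ft).transpose * normalCovariance L M (sym (τ i)) * sectorSubMatrix L M β Ft))).reverse).prod
          (dblCopy ℂ 0 a * dblCopy ℂ 1 b)) m (fun i => (Z i, s i))‖ ≤
      (((k + m₀).factorial * (k + m₁).factorial : ℝ) / (m.factorial * (k - (e' + 1)).factorial)) * (∑ t, κ t ^ 2) ^ (k - (e' + 1)) *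
        (α * (∏ i, δ i * ((4 * ρ₀ : ℕ) : ℝ)) * Na * Nb) := by
  classical
  refine sum_norm_kernel_crossContract_le_gram (fun Y : SpaceTimeIdx L M × SectorLeg N => decide (Y.2.2 = 0))
    (fun t => (sectorSubMatrix L M β Ft).transpose * normalCovariance L M (sym t) * sectorSubMatrix L M β Ft)
    (fun t X Y hq => pullback_normalCovariance_apply_of_charge_eq β Ft (sym t) (fin_two_eq_of_iff' (by simpa using hq)))
    (fun t => sectorGramF L M β Ft (sym t)) (fun t => sectorGramG L M β Ft (sym t)) κ
    (fun t X hX => hκF t X (by simpa using hX)) (fun t Y hY => hκG t Y ?_)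
    (fun t X Y hX hY => contr_pullback_normalCovariance_eq_inner β Ft (sym t) (by simpa using hX) ?_)
    he (fun i => (sectorSubMatrix L M β Ft).transpose * normalCovariance L M (sym (τ i)) * sectorSubMatrix L M β Ft) τ (fun i _ => rfl)
    a b s hm₀ hm₁ p hp z (sum_norm_contr_le _ hrow hcol)
    (fun _ σ τ'' => if (∃ q, Ft σ.1.1 q * Ft τ''.1.1 q ≠ 0) then (1 : ℝ) else 0) (fun _ σ τ'' => by positivity)
    δ (fun _ => ((4 * ρ₀ : ℕ) : ℝ)) hδ
    (fun i X Y => norm_contr_le_indicator_of_support _ (fun σ τ'' : SectorLeg N => ∃ q, Ft σ.1.1 q * Ft τ''.1.1 q ≠ 0)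
      (fun σ τ'' ⟨q, hq⟩ => ⟨q, by rwa [mul_comm] at hq⟩) (hδ i) (hent i)
      (fun X Y hXY => exists_mul_ne_zero_of_pullback_normalCovariance_ne_zero β Ft (sym _) hXY) X Y)
    (fun _ σ => sum_indicator_le_of_card_le (fun σ τ'' : SectorLeg N => ∃ q, Ft σ.1.1 q * Ft τ''.1.1 q ≠ 0) (fun σ' => ?_) σ) hNb0 hNa hNb
  · have h2 : (Y.2.2 : Fin 2) ≠ 0 := by simpa using hY
    omega
  · have h2 : (Y.2.2 : Fin 2) ≠ 0 := by simpa using hY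
    omega
  · exact (card_filter_sectorLeg_le fun ω' => ∃ q, Ft σ'.1.1 q * Ft ω' q ≠ 0).trans (Nat.mul_le_mul_left 4 (hρ₀ σ'.1.1))

/-- **Norm form with a Gram tail in engine currency, family keying** (pinned output leg from `Ga`): `Ga` in the plain `F`-sectorised norm
`‖Ga‖_{k+m₀, univ}`, `Gb` pinned at its line-`0` leg with the sectors of its explicit legs `1 … e'` prescribed (`F`-level `e'`); base `Σ_{s∈ι} κ_s²`.
[cite: BenfattoGiulianiMastropietro2006, §2.8 (2.80)] -/
theorem sum_norm_kernel_crossContract_sectorPreimage_le_gramF {k e' m m₀ m₁ : ℕ} (he : e' + 1 ≤ k) {β : ℝ} (hβ : 0 ≤ β)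
    (F Ft : Fin N → FreqMomentum L M → ℂ)
    {ρ₀ : ℕ} (hρ₀ : ∀ ω : Fin N, ((univ : Finset (Fin N)).filter fun ω' => ∃ q, Ft ω q * Ft ω' q ≠ 0).card ≤ ρ₀)
    (sym : ι → FreqMomentum L M × Fin 2 → ℂ) (τ : Fin k → ι) (κ : ι → ℝ)
    (hκF : ∀ (s : ι) (Y : SpaceTimeIdx L M × SectorLeg N), Y.2.2 = 0 → ‖sectorGramF L M β Ft (sym s) Y‖ ≤ κ s)
    (hκG : ∀ (s : ι) (Y : SpaceTimeIdx L M × SectorLeg N), Y.2.2 = 1 → ‖sectorGramG L M β Ft (sym s) Y‖ ≤ κ s)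
    (Ga Gb : HubbardGrassmann L M) (s : Fin m → Fin 2)
    (hm₀ : (univ.filter fun i => s i = 0).card = m₀) (hm₁ : (univ.filter fun i => s i = 1).card = m₁) (p : Fin m) (hp : s p = 0)
    (z : SpaceTimeIdx L M × SectorLeg N) {α : ℝ}
    (hrow : ∀ X, ∑ Y, ‖((sectorSubMatrix L M β Ft).transpose * normalCovariance L M (sym (τ (Fin.castLE he 0))) * sectorSubMatrix L M β Ft) X Y‖ ≤ α)
    (hcol : ∀ Y, ∑ X, ‖((sectorSubMatrix L M β Ft).transpose * normalCovariance L M (sym (τ (Fin.castLE he 0))) * sectorSubMatrix L M β Ft) X Y‖ ≤ α)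
    (δ : Fin e' → ℝ) (hδ : ∀ i, 0 ≤ δ i)
    (hent : ∀ (i : Fin e') X Y,
      ‖((sectorSubMatrix L M β Ft).transpose * normalCovariance L M (sym (τ (Fin.castLE he i.succ))) * sectorSubMatrix L M β Ft) X Y‖ ≤ δ i)
    {Nb : ℝ} (hNb0 : 0 ≤ Nb)
    (hNb : ∀ τ' : Fin e' → SectorLeg N, hubbardSectorKernelNorm L M β F (prescribedTuples univ
      (Fin.append (fun i : Fin k => if h : (i : ℕ) < e' + 1 then
        (Fin.cons none (fun j => some (τ' j)) : Fin (e' + 1) → Option (SectorLeg N)) ⟨i, h⟩ else none) (fun _ : Fin m₁ => none))) Gb ≤ Nb) :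
    ∑ Z ∈ univ.filter (fun Z : Fin m → SpaceTimeIdx L M × SectorLeg N => Z p = z),
        ‖kernel ℂ (((List.ofFn fun i => grassmannLaplacian ℂ (crossCov ℂ
            ((sectorSubMatrix L M β Ft).transpose * normalCovariance L M (sym (τ i)) * sectorSubMatrix L M β Ft))).reverse).prod
          (dblCopy ℂ 0 (sectorPreimage β F Ga) * dblCopy ℂ 1 (sectorPreimage β F Gb))) m (fun i => (Z i, s i))‖ ≤
      (((k + m₀).factorial * (k + m₁).factorial : ℝ) / (m.factorial * (k - (e' + 1)).factorial)) * (∑ t, κ t ^ 2) ^ (k - (e' + 1)) *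
        (α * (∏ i, δ i * ((4 * ρ₀ : ℕ) : ℝ)) *
          (imagTimeWeight β M * hubbardSectorKernelNorm L M β F (univ : Finset (Fin (k + m₀) → SectorLeg N)) Ga) *
          (imagTimeWeight β M * Nb)) :=
  sum_norm_kernel_crossContract_pullback_le_gramF he β Ft hρ₀ sym τ κ hκF hκG (sectorPreimage β F Ga) (sectorPreimage β F Gb) s hm₀ hm₁ p hp z
    hrow hcol δ hδ hent (mul_nonneg (imagTimeWeight_nonneg hβ M) hNb0)
    (fun p₀ => sum_pinned_norm_kernel_sectorPreimage_le hβ F Ga p₀ z)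
    fun Y₀ τ' => (sum_sum_sum_filter_castLE_norm_kernel_sectorPreimage_le hβ F Gb he Y₀ τ').trans
      (mul_le_mul_of_nonneg_left (hNb τ') (imagTimeWeight_nonneg hβ M))

end FamilyNorm

end Summit.HubbardSuperconductivity.HubbardSuperconductivity.Theorems.KLRegimeWick

end
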